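import Mathlib
import Summits.ValiantsHypothesis.ValiantsHypothesis.Theorems.NewtonUnitEquationsNewtonTauWeakGradedDesignT2

/-!
# `NewtonUnitEquationsNewtonTauWeakUnionVertexBound` — hull vertices of a finite union of planar pieces

Registered stub `stub_unionVertexBound` of line `binomial-normal-form` (crux `NewtonTauWeak`,
stmt-ValiantsHypothesis-5904, lead c7, THEOREM W♯): the union step of the Gusfield halving argument, which
writes a weighted level set as a finite union (`Finset.biUnion`) of Minkowski pieces.

Claim.  For finite sets `S i ⊆ ℕ²` (`i ∈ s`) embedded in `ℝ²` by `emb e i = (e i : ℝ)`, the number of hull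
vertices of `emb '' (⋃_{i∈s} S i)` is at most the sum over `i ∈ s` of the number of hull vertices of
`emb '' (S i)`.

Proof.  An extreme point `x` of `conv(emb '' ⋃_i S i) = conv(⋃_i emb '' S i)` lies in `⋃_i emb '' S i`
(`extremePoints_convexHull_subset`), hence in some `emb '' S i ⊆ conv(emb '' S i) ⊆ conv(⋃_i emb '' S i)`, and
an extreme point of the bigger convex set lying in the smaller one is extreme there
(`inter_extremePoints_subset_extremePoints_of_subset`).  So `ext(⋃) ⊆ ⋃_{i∈s} ext(S i)`, all these sets are
finite, and `ncard` is subadditive over finite unions (`Finset.set_ncard_biUnion_le`).  This is exactly the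
union step `GradedDesignT2Aux.ncard_extremePoints_convexHull_biUnion_le` of the sibling file
`NewtonUnitEquationsNewtonTauWeakGradedDesignT2`, which we reuse by import after rewriting the coerced
`Finset.biUnion` as a set-indexed union (`Finset.coe_biUnion`, `Set.image_iUnion₂`).

Everything is folklore (extreme points of the hull of a union); no named facts, no citations, no `def`s.
[folklore]
-/

-- Sub = Summit single-conjunct layout: the duplicated namespace component is mandated by the tree.
set_option linter.dupNamespace false

noncomputable section

open scoped BigOperators

namespace Summit.ValiantsHypothesis.ValiantsHypothesis.Theorems.NewtonUnitEquationsNewtonTauWeak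

/-- **Hull vertices of a finite union (union step of THEOREM W♯).**  For finitely many finite planar sets
`S i ⊆ ℕ²` embedded coordinatewise in `ℝ²`, the hull of the union `⋃_{i∈s} S i` has at most
`Σ_{i∈s} #ext conv(emb '' S i)` vertices: every extreme point of the hull of the union lies in one of the
pieces and is then extreme in the hull of that piece. [folklore] -/
theorem stub_unionVertexBound {ι : Type} (s : Finset ι) (S : ι → Finset (Fin 2 →₀ ℕ)) :
    (Set.extremePoints ℝ (convexHull ℝ ((fun e : Fin 2 →₀ ℕ => fun i : Fin 2 => ((e i : ℕ) : ℝ)) ''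
      ((s.biUnion S : Finset (Fin 2 →₀ ℕ)) : Set (Fin 2 →₀ ℕ))))).ncard ≤
      ∑ i ∈ s, (Set.extremePoints ℝ (convexHull ℝ ((fun e : Fin 2 →₀ ℕ => fun i : Fin 2 => ((e i : ℕ) : ℝ)) ''
        (S i : Set (Fin 2 →₀ ℕ))))).ncard := by
  rw [Finset.coe_biUnion, Set.image_iUnion₂]
  exact GradedDesignT2Aux.ncard_extremePoints_convexHull_biUnion_le s _ fun i _ =>
    (Finset.finite_toSet _).image _

end Summit.ValiantsHypothesis.ValiantsHypothesis.Theorems.NewtonUnitEquationsNewtonTauWeak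

end
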